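import Literature.AnabelianGeometry.EtaleTheta.LogDivisorModelConstantFieldGalois
import Literature.AnabelianGeometry.EtaleTheta.Discharge.Sec3Prop34iiOfGaloisCovering

/-!
# [EtTh] Prop. 3.4 (ii) IN PRINT'S VOCABULARY at a constant-field structure: `O_L^×`, `O_L^▷`, `L^×` of the
# constant field `L = L'^{Gal}` of a connected covering versus `Ker(div₀)`, `B₀ ×_{Φ₀^gp} Φ₀`, `F₀`

S. Mochizuki, *The étale theta function …*, Publ. RIMS **45** (2009) [MochizukiEtTh2009], §3, Prop. 3.4 (ii), PRIMS PDF
p.74: "Suppose that `Y^log → X^log` is a connected tempered covering such that the composite morphism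
`Y^log → Spec(K)` factors through `Spec(L)`, for some finite extension `L` of `K`, in such a way that `Y^log` is
geometrically connected over `L`.  Then we have natural isomorphisms of monoids
`O_L^× ⥲ Ker(B₀(Y^log) → Φ₀^gp(Y^log)) ⊆ B₀(Y^log)`; `O_L^▷ ⥲ B₀(Y^log) ×_{Φ₀^gp(Y^log)} Φ₀(Y^log)`;
`L^× ⥲ F₀(Y^log) ⊆ B₀(Y^log)`" [cite: MochizukiEtTh2009, Prop 3.4 p.74].

PROOF-ONLY (abc-iut cell, W6 seat d058 lineage, gen 3; 0 defs).  At the Def. 3.3 (iii) data of the coverings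
dominated by `Z^log_∞` the three isomorphisms were proved (p437192, `Sec3Prop34iiOfGaloisCovering.lean`) with the
constants appearing only as the abstract submonoids `intConst ⊆ const ⊆ Fn`.  With a constant-field structure
`C : GaloisAction.ConstField A K L' Γ₀` (`LogDivisorModelConstantFieldGalois.lean`: `L'` the constant field of
`Z^log_∞`, `res : G ↠ Aut(L'/K)`, `emb : L'^× ≅ const`, `O_{L'}^▷ = {v ≤ 1}`) they take PRINT'S FORM: for the connected
covering `Y ↔ G/H`, its constant field is the intermediate field `L := L'^{res(H)}` (Mathlib
`IntermediateField.fixedField (H.map C.res)`), and evaluation at the base point `b ↦ b(1) = emb x` matches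
* `F₀(G/H)` with `L^×` (`mem_fZero_quotient_iff`, `exists_fZero_quotient`, uniqueness `eq_of_bZero_quotient`);
* `Ker(div₀)(G/H)` with `O_L^× = {x ∈ L | v x = 1}` (`divZeroHom_quotient_eq_one_iff`);
* `(B₀ ×_{Φ₀^gp} Φ₀)(G/H)` with `O_L^▷ = {x ∈ L^× | v x ≤ 1}` (`exists_divZeroHom_quotient_eq_of_iff`).
(`emb_invariant_iff_mem_fixedField`: an `emb x` is `H`-invariant iff `x ∈ L'^{res(H)}`.)  HONEST FRAMING:
theorems about a construction over typed interfaces (one term of Def. 3.3 (iii)'s limit); nothing here bears on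
[IUTchIII] Cor. 3.12; no side taken; typed ≠ proved for anything else.
-/

namespace Literature.AnabelianGeometry.EtaleTheta

namespace LogDivisorModel.GaloisAction.ConstField

open CategoryTheory

universe u v w

variable {Z : LogDivisorModel.{u}} {G : Type u} [Group G] {A : Z.GaloisAction G}
  {K L : Type v} [Field K] [Field L] [Algebra K L] {Γ₀ : Type w} [LinearOrderedCommGroupWithZero Γ₀]
  (C : A.ConstField K L Γ₀) (H : Subgroup G)

/-- The constant field of the covering `Y ↔ G/H` is `L'^{res(H)}`: an element of `L'` lies in the fixed field of
`res(H)` iff every `h ∈ H` fixes it. [cite: MochizukiEtTh2009, Prop 3.4 p.74] -/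
theorem mem_fixedField_map_iff (x : L) :
    x ∈ IntermediateField.fixedField (H.map C.res) ↔ ∀ h ∈ H, C.res h x = x := by
  rw [IntermediateField.mem_fixedField_iff]
  constructor
  · intro hx h hh
    exact hx (C.res h) (Subgroup.mem_map_of_mem C.res hh)
  · rintro hx σ ⟨h, hh, rfl⟩
    exact hx h hh

/-- The constant function `emb x` is `H`-invariant iff `x` lies in the constant field `L'^{res(H)}` of `G/H`.
[cite: MochizukiEtTh2009, Prop 3.4 p.74] -/
theorem emb_invariant_iff_mem_fixedField (x : Lˣ) :
    (∀ h ∈ H, A.actFn h (C.emb x) = C.emb x) ↔ (x : L) ∈ IntermediateField.fixedField (H.map C.res) := by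
  rw [C.mem_fixedField_map_iff]
  exact forall₂_congr fun h _ => C.actFn_emb_eq_iff h x

/-- **Prop. 3.4 (ii), isomorphism 3 in print's form: `L^× ⥲ F₀(Y^log)`** for `Y ↔ G/H`, `L = L'^{res(H)}`: an
equivariant log-meromorphic family on `G/H` is constant (`∈ F₀`) iff its base-point value is `emb x` for a (unique,
`emb` injective) `x ∈ L^×`. [cite: MochizukiEtTh2009, Prop 3.4 p.74] -/
theorem mem_fZero_quotient_iff (b : A.bZero (Action.ofMulAction G (G ⧸ H))) :
    b ∈ A.fZero (Action.ofMulAction G (G ⧸ H)) ↔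
      ∃ x : Lˣ, (x : L) ∈ IntermediateField.fixedField (H.map C.res) ∧ b.1 ((1 : G) : G ⧸ H) = C.emb x := by
  constructor
  · intro hb
    obtain ⟨x, hx⟩ := (C.mem_const_iff _).1 (hb ((1 : G) : G ⧸ H))
    refine ⟨x, (C.emb_invariant_iff_mem_fixedField H x).1 fun h hh => ?_, hx.symm⟩
    rw [hx]
    exact A.bZero_quotient_invariant H b h hh
  · rintro ⟨x, -, hb1⟩ q
    induction q using QuotientGroup.induction_on with
    | H g =>
      rw [A.bZero_quotient_apply H b g, hb1]
      exact A.act_mem_const g (C.emb_mem_const x)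

/-- … and every `x ∈ L^×` occurs: the constant family `g ↦ g·emb x` on `G/H` (surjectivity of `L^× → F₀(Y^log)`).
[cite: MochizukiEtTh2009, Prop 3.4 p.74] -/
theorem exists_fZero_quotient (x : Lˣ) (hx : (x : L) ∈ IntermediateField.fixedField (H.map C.res)) :
    ∃ b : A.bZero (Action.ofMulAction G (G ⧸ H)),
      b ∈ A.fZero (Action.ofMulAction G (G ⧸ H)) ∧ b.1 ((1 : G) : G ⧸ H) = C.emb x := by
  obtain ⟨b, hb⟩ := A.exists_bZero_quotient_of_invariant H (Z.const_le_logMero (C.emb_mem_const x))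
    ((C.emb_invariant_iff_mem_fixedField H x).2 hx)
  exact ⟨b, (C.mem_fZero_quotient_iff H b).2 ⟨x, hx, hb⟩, hb⟩

/-- Injectivity of `L^× → F₀(Y^log)` / well-definedness of its inverse: two equivariant families on `G/H` with the
same constant base-point value coincide. [cite: MochizukiEtTh2009, Prop 3.4 p.74] -/
theorem fZero_quotient_unique (b c : A.bZero (Action.ofMulAction G (G ⧸ H))) (x : Lˣ)
    (hb : b.1 ((1 : G) : G ⧸ H) = C.emb x) (hc : c.1 ((1 : G) : G ⧸ H) = C.emb x) : b = c :=
  A.eq_of_bZero_quotient H b c (by rw [hb, hc])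

/-- **Prop. 3.4 (ii), isomorphism 1 in print's form: `O_L^× ⥲ Ker(B₀(Y^log) → Φ₀^gp(Y^log))`**: an equivariant
family on `G/H` has trivial log-divisor iff its base-point value is `emb x` with `x ∈ L = L'^{res(H)}` a unit of the
valuation ring (`v x = 1`). [cite: MochizukiEtTh2009, Prop 3.4 p.74] -/
theorem divZeroHom_quotient_eq_one_iff (b : A.bZero (Action.ofMulAction G (G ⧸ H))) :
    A.divZeroHom (Action.ofMulAction G (G ⧸ H)) b = 1 ↔
      ∃ x : Lˣ, (x : L) ∈ IntermediateField.fixedField (H.map C.res) ∧ C.v (x : L) = 1 ∧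
        b.1 ((1 : G) : G ⧸ H) = C.emb x := by
  rw [A.divZeroHom_eq_one_iff]
  constructor
  · intro hb
    obtain ⟨x, hxF, hb1⟩ := (C.mem_fZero_quotient_iff H b).1 fun q => Z.intConst_le_const (hb q).1
    refine ⟨x, hxF, ?_, hb1⟩
    have h1 := hb ((1 : G) : G ⧸ H)
    rw [hb1] at h1
    exact C.valuation_eq_one_of_mem_intConst x h1.1 h1.2
  · rintro ⟨x, -, hv, hb1⟩ q
    induction q using QuotientGroup.induction_on with
    | H g =>
      obtain ⟨hi, hi'⟩ := C.emb_mem_intConst_and_inv_mem x hv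
      rw [A.bZero_quotient_apply H b g, hb1, ← map_inv]
      exact ⟨A.act_mem_intConst g hi, A.act_mem_intConst g hi'⟩

/-- **Prop. 3.4 (ii), isomorphism 2 in print's form: `O_L^▷ ⥲ B₀(Y^log) ×_{Φ₀^gp(Y^log)} Φ₀(Y^log)`**: an
equivariant family on `G/H` has EFFECTIVE (Cartier) log-divisor iff its base-point value is `emb x` with
`x ∈ L = L'^{res(H)}` integral (`v x ≤ 1`). [cite: MochizukiEtTh2009, Prop 3.4 p.74] -/
theorem exists_divZeroHom_quotient_eq_of_iff (b : A.bZero (Action.ofMulAction G (G ⧸ H))) :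
    (∃ φ : A.phiZero (Action.ofMulAction G (G ⧸ H)),
        A.divZeroHom (Action.ofMulAction G (G ⧸ H)) b = Algebra.GrothendieckGroup.of φ) ↔
      ∃ x : Lˣ, (x : L) ∈ IntermediateField.fixedField (H.map C.res) ∧ C.v (x : L) ≤ 1 ∧
        b.1 ((1 : G) : G ⧸ H) = C.emb x := by
  rw [A.exists_divZeroHom_eq_of_iff]
  constructor
  · intro hb
    obtain ⟨x, hxF, hb1⟩ := (C.mem_fZero_quotient_iff H b).1 fun q => Z.intConst_le_const (hb q)
    refine ⟨x, hxF, ?_, hb1⟩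
    have h1 := hb ((1 : G) : G ⧸ H)
    rw [hb1] at h1
    exact (C.emb_mem_intConst_iff x).1 h1
  · rintro ⟨x, -, hv, hb1⟩ q
    induction q using QuotientGroup.induction_on with
    | H g =>
      rw [A.bZero_quotient_apply H b g, hb1]
      exact A.act_mem_intConst g ((C.emb_mem_intConst_iff x).2 hv)

/-- The three statements at the covering `Z_∞` itself (`H = 1`, constant field `L'`): a family on `G/1` is constant
iff its base-point value is `emb x` for some `x ∈ L'^×` (no fixed-field condition). [cite: MochizukiEtTh2009, Prop 3.4 p.74] -/
theorem mem_fZero_quotient_bot_iff (b : A.bZero (Action.ofMulAction G (G ⧸ (⊥ : Subgroup G)))) :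
    b ∈ A.fZero (Action.ofMulAction G (G ⧸ (⊥ : Subgroup G))) ↔
      ∃ x : Lˣ, b.1 ((1 : G) : G ⧸ (⊥ : Subgroup G)) = C.emb x := by
  rw [C.mem_fZero_quotient_iff]
  refine exists_congr fun x => ⟨fun h => h.2, fun h => ⟨?_, h⟩⟩
  rw [← C.emb_invariant_iff_mem_fixedField]
  intro g hg
  rw [Subgroup.mem_bot.1 hg, map_one, MulAut.one_apply]

end LogDivisorModel.GaloisAction.ConstField

end Literature.AnabelianGeometry.EtaleTheta
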